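import Literature.AlgebraicGeometry.HodgeTheory.StablyNondegenerateHodgeLieTotallyRealField
import HarnessLib

/-!
# Milne's Prop. 4.8 (a) ⇒ (c) in Lie form OVER `ℂ`: for a stably nondegenerate complex abelian variety, every square-zero `ψ_ℂ`-skew operator of `H¹(A;ℚ) ⊗ ℂ` commuting with `End⁰(A) ⊗ ℂ` lies in `Lie Hg(H¹A) ⊗ ℂ` (complex transvections of `S(A)(ℂ)`; Deligne I §3, GGK (I.B.1))

HONEST FRAMING (cell `pub-hodge-ring2`, verbatim): «research route conditional on HC_CM; not a corollary;
Q11.4-sentence-2 already refuted in dim ≥ 3». For THIS file: step (F1) of the Literature lane's programme R56 (Hazama 1989 /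
Moonen–Zarhin Thm. (3.2)(1) for a second factor of TYPE II); its content is UNCONDITIONAL (theorems only, no definition, no
named fact, nothing here depends on `HC_CM`; the Betti inputs are the tree theorems `exists_isReal_hodgeModel_holds`,
`hodgePQ_independent_of_hodgeModel_holds`, `hodgeTensorFacts_holds`, kept as binders exactly as in the tree's
`StablyNondegenerateHodgeLieSymplectic`); no step towards a summit statement beyond the published theorems it formalizes.

WHY. The tree's `mem_hodgeLie_of_isStablyNondegenerate_of_transvection_mem_unitaryCentralizerGroup`
(`StablyNondegenerateHodgeLieSymplectic` §8) puts a RATIONAL nilpotent `ψ`-skew `N` with `exp N ∈ S(A)(ℂ)` into `Lie Hg(H¹A)` when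
`A` is stably nondegenerate. For a second factor of type II (`End⁰(S) = D` a totally indefinite quaternion algebra) Milne's group
`S(S) = ` centraliser of `D` in `Sp` may be ANISOTROPIC over `ℚ` (quaternion rank one: `S(S)(ℚ) = D^{×, Nrd = 1}` has no
unipotents), so the rational criterion is empty; but `S(S)_ℂ ≅ ∏ Sp` is full of unipotents. This file is the COMPLEX form of the
criterion: the one-parameter transvections `1 + tY`, `t ∈ ℂ`, of a square-zero `ψ_ℂ`-skew `Y ∈ End_ℂ(H¹(A;ℚ) ⊗ ℂ)` commuting with
`End_Hdg ⊗ ℂ` lie in `S(A)(ℂ)`, hence (Milne 4.8 (a) ⇒ (c), the tree's `diagPowExterior_apply_eq_self_of_isStablyNondegenerate`)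
fix the Hodge classes of all powers, hence (differentiating the polynomial identity `(1 + tY)^{⊗m} y = y` at `t = 0`, §0) `Y`
kills the complexified Hodge tensors, i.e. `Y ∈ Lie Hg(H¹A) ⊗ ℂ` (`mem_hodgeLieC_iff`: `Hg` is defined over `ℚ`).

THE PRINT. J. S. Milne, *Lefschetz classes on abelian varieties*, Duke Math. J. **96** (1999), Prop. 4.8 (p. 660): «The following
are equivalent: (a) no power of `A` supports an exotic Hodge class; … (c) `Hg′(A) = S(A)`», with §1 p. 644 (`S(A)` = the
centraliser of `End⁰(A)` in `Sp(e_D)`) and Thm. 4.4; B. Moonen, Yu. Zarhin, Math. Ann. **315** (1999) (1.8): «`Hg(X) = Sp_D(V, φ)`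
⟺ `D(Xⁿ) = B(Xⁿ)` for all `n`»; P. Deligne, LNM 900 (1982), I §3.1, Prop. 3.4 (the group is the stabiliser of the rational tensors
of type `(p,p)`; its Lie algebra their annihilator); M. Green, P. Griffiths, M. Kerr, *Mumford–Tate Groups and Domains* (2012),
(I.B.1); A. Borel, *Linear Algebraic Groups*, §3.9, §7.3 (the Lie algebra of a one-parameter unipotent subgroup is read off the
linear term).

MAIN RESULTS (all proved).
* §0 (any field of characteristic `0`) **`piTensorDerivation_apply_eq_zero_of_forall_map_one_add_smul`**: if
  `(1 + tN)^{⊗m} y = y` for every scalar `t`, then the Leibniz action `D_m(N)` kills `y` (expand by multilinearity in the slots,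
  `PiTensorProduct.mapMultilinear`, and compare coefficients of the vector-valued polynomial in `t`,
  `eq_zero_of_forall_sum_pow_smul_eq`); `tensorDerivation_toTensorSpaceZeroOver`.
* §1 (abstract polarized `ℚ`-Hodge structures) **`mem_hodgeLieC_of_skew_of_forall_tensorSpace_zero`**: the COMPLEX covariant-tensor
  criterion — a `Q_ℂ`-skew `Y ∈ End_ℂ(V_ℂ)` whose action `ρ_{m,0}(Y)` kills the complexifications of the Hodge classes of type
  `(p,p)` of every `T^{m,0} H` lies in `𝔥(H) ⊗ ℂ` (the tree's rational `mem_hodgeLie_of_skew_of_forall_tensorSpace_zero` with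
  `θ_ℂ = Q_ℂ♭`, `Polarization.toDualEquivC`; `covariantize_tensorDerivation` is over any field).
* §2 (complex abelian varieties) **`symm_trans_trans_mem_unitaryCentralizerGroup_of_forall_form_eq`**: every `ψ_ℂ`-symplectic
  `ℂ`-linear automorphism of `H¹(A;ℚ) ⊗ ℂ` commuting with `End_Hdg(H¹) ⊗ ℂ` lies, transported to `H¹(A(ℂ); ℂ)`, in Milne's
  `S(A)(ℂ) = unitaryCentralizerGroup A D.Hη` (the tree's rational bridge `mem_unitaryCentralizerGroup_of_forall_form_eq_of_forall_comp_eq`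
  verbatim for a complex `U`); **`mem_hodgeLieC_of_forall_diagPowExterior_one_add_smul`** (Deligne I §3 ⟸ over `ℂ`: if the
  transvections `1 + tY` act on `H¹(A(ℂ); ℂ)` through elements of `(C(A) ⊗ ℂ)^×` whose exterior diagonal action fixes every
  rational `(p,p)`-class of every power, then `Y ∈ Lie Hg ⊗ ℂ`); and the headline
  **`mem_hodgeLieC_of_isStablyNondegenerate_of_mul_self_eq_zero`**: for `A` stably nondegenerate of positive dimension, every
  `Y ∈ End_ℂ(H¹(A;ℚ) ⊗ ℂ)` with `Y² = 0`, `ψ_ℂ`-skew and commuting with every `a ⊗ 1`, `a ∈ End_Hdg(H¹(A;ℚ))`, lies in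
  `Lie Hg(H¹A) ⊗ ℂ`; `mem_hodgeLieC_of_isStablyNondegenerate_of_mem_span_transvections` (the `ℂ`-span of such `Y`).

## References

* [Milne1999LefschetzClasses] J. S. Milne, Duke Math. J. 96 (1999), §1 p. 644, Thm. 4.4, Prop. 4.8 (p. 660).
  [cite: Milne1999LefschetzClasses, Prop. 4.8 (p. 660)]
* [MoonenZarhin1999LowDim] B. Moonen, Yu. Zarhin, Math. Ann. 315 (1999), §1 (1.8). [cite: MoonenZarhin1999LowDim, §1 (1.8)]
* [Deligne1982HodgeCycles] P. Deligne, LNM 900 (1982), I §3.1, Prop. 3.4, proof of Prop. 3.6.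
  [cite: Deligne1982HodgeCycles, I §3.1 and Prop. 3.4]
* [GreenGriffithsKerr2012] M. Green, P. Griffiths, M. Kerr, Ann. of Math. Stud. 183 (2012), §I.B (I.B.1).
  [cite: GreenGriffithsKerr2012, §I.B (I.B.1)]
* [Borel1991] A. Borel, *Linear Algebraic Groups*, GTM 126 (1991), §3.9 and §7.3. [cite: Borel1991, §3.9 and §7.3]
* [LangeBirkenhake1992] H. Lange, Ch. Birkenhake, *Complex Abelian Varieties*, Lemma 1.1.17, Prop. 5.2.1.
  [cite: LangeBirkenhake1992, Lemma 1.1.17 and Prop. 5.2.1]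
-/

noncomputable section

open scoped TensorProduct PiTensorProduct
open CategoryTheory Module

/-! ### §0 One-parameter unipotent families on tensor powers: `(1 + tN)^{⊗m} y = y` for all `t` forces `D_m(N) y = 0` -/

namespace Literature.AlgebraicGeometry.Motives

section OneParameter

universe u v w

variable {K : Type u} [Field K] [CharZero K] {W : Type v} [AddCommGroup W] [Module K W]

/-- **A vector-valued polynomial vanishing at every scalar has vanishing coefficients**: if `Σ_{i ≤ m} tⁱ · bᵢ` is
independent of `t ∈ K` (`K` of characteristic `0`, hence infinite), then `bᵢ = 0` for `1 ≤ i ≤ m` (test against every linear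
form and use `Polynomial.eq_zero_of_infinite_isRoot`). [cite: Borel1991, §3.9 and §7.3] -/
theorem eq_zero_of_forall_sum_pow_smul_eq {M : Type w} [AddCommGroup M] [Module K M] (m : ℕ) (b : ℕ → M) (c : M)
    (h : ∀ t : K, ∑ i ∈ Finset.range (m + 1), t ^ i • b i = c) {i : ℕ} (hi : 1 ≤ i) (him : i ≤ m) : b i = 0 := by
  rw [← Module.forall_dual_apply_eq_zero_iff K]
  intro ℓ
  set P : Polynomial K := ∑ j ∈ Finset.range (m + 1), Polynomial.C (ℓ (b j)) * Polynomial.X ^ j -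
    Polynomial.C (ℓ c) with hP_def
  have hP : ∀ t : K, P.eval t = ℓ (∑ j ∈ Finset.range (m + 1), t ^ j • b j) - ℓ c := by
    intro t
    rw [hP_def, Polynomial.eval_sub, Polynomial.eval_C, Polynomial.eval_finsetSum, map_sum]
    simp only [Polynomial.eval_mul, Polynomial.eval_C, Polynomial.eval_pow, Polynomial.eval_X, map_smul, smul_eq_mul,
      mul_comm (ℓ (b _))]
  have hroots : Set.Infinite {x : K | P.IsRoot x} := by
    refine Set.infinite_of_injective_forall_mem Nat.cast_injective fun k => ?_
    change P.IsRoot (k : K)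
    rw [Polynomial.IsRoot, hP, h, sub_self]
  have hP0 : P = 0 := Polynomial.eq_zero_of_infinite_isRoot P hroots
  have hi0 : i ≠ 0 := by omega
  have hc1 : P.coeff i = ℓ (b i) := by
    rw [hP_def, Polynomial.coeff_sub, Polynomial.coeff_C, if_neg hi0, sub_zero, Polynomial.finsetSum_coeff,
      Finset.sum_eq_single i]
    · rw [Polynomial.coeff_C_mul_X_pow, if_pos rfl]
    · intro j _ hj
      rw [Polynomial.coeff_C_mul_X_pow, if_neg (Ne.symm hj)]
    · intro h'
      exact absurd (Finset.mem_range.2 (by omega)) h'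
  rw [← hc1, hP0, Polynomial.coeff_zero]

/-- **The linear term of `t ↦ (1 + tN)^{⊗m}` is the Leibniz action**: if `(1 + tN)^{⊗m} y = y` for every `t ∈ K`, then
`D_m(N) y = 0` (`D_m(N) = Σₖ 1 ⊗ ⋯ ⊗ N ⊗ ⋯ ⊗ 1`, the tree's `piTensorDerivation`). Expanding by multilinearity of
`f ↦ ⊗ₖ fₖ` (`PiTensorProduct.mapMultilinear`, `MultilinearMap.map_add_univ`, `map_piecewise_smul`),
`(1 + tN)^{⊗m} y = Σ_S t^{|S|} · (N on the slots of `S`) y`; the coefficient of `t¹` is `Σₖ (N in slot k) y = D_m(N) y`, and all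
positive-degree coefficients vanish (`eq_zero_of_forall_sum_pow_smul_eq`). This is the Lie algebra `K · D_m(N)` of the
one-parameter unipotent subgroup `t ↦ (1 + tN)^{⊗m}` read off its linear term. [cite: Borel1991, §3.9 and §7.3]
[cite: Deligne1982HodgeCycles, I §3.1] -/
theorem piTensorDerivation_apply_eq_zero_of_forall_map_one_add_smul (m : ℕ) (N : Module.End K W) (y : ⨂[K]^m W)
    (h : ∀ t : K, PiTensorProduct.map (fun _ : Fin m => (1 : Module.End K W) + t • N) y = y) :
    piTensorDerivation m N y = 0 := by
  classical
  -- the coefficient tensors `c S = (N on the slots of S) y`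
  set c : Finset (Fin m) → ⨂[K]^m W := fun S =>
    PiTensorProduct.map (S.piecewise (fun _ : Fin m => N) (fun _ : Fin m => (1 : Module.End K W))) y with hc
  -- the expansion `(1 + tN)^{⊗m} y = Σ_S t^{|S|} • c S`
  have hexp : ∀ t : K, PiTensorProduct.map (fun _ : Fin m => (1 : Module.End K W) + t • N) y =
      ∑ S : Finset (Fin m), t ^ S.card • c S := by
    intro t
    have h1 : (fun _ : Fin m => (1 : Module.End K W) + t • N) =
        (fun _ : Fin m => t • N) + (fun _ : Fin m => (1 : Module.End K W)) := by
      funext i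
      simp only [Pi.add_apply, add_comm]
    rw [← PiTensorProduct.mapMultilinear_apply, h1, MultilinearMap.map_add_univ, LinearMap.sum_apply]
    refine Finset.sum_congr rfl fun S _ => ?_
    have h2 : S.piecewise (fun _ : Fin m => t • N) (fun _ : Fin m => (1 : Module.End K W)) =
        S.piecewise (fun i => (fun _ : Fin m => t) i •
          (S.piecewise (fun _ : Fin m => N) (fun _ : Fin m => (1 : Module.End K W))) i)
          (S.piecewise (fun _ : Fin m => N) (fun _ : Fin m => (1 : Module.End K W))) := by
      funext i
      by_cases hi : i ∈ S
      · simp only [Finset.piecewise_eq_of_mem _ _ _ hi]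
      · simp only [Finset.piecewise_eq_of_notMem _ _ _ hi]
    rw [h2, MultilinearMap.map_piecewise_smul, Finset.prod_const, PiTensorProduct.mapMultilinear_apply,
      LinearMap.smul_apply]
  -- regroup by cardinality: `Σ_S t^{|S|} c S = Σ_{i ≤ m} tⁱ • b i`
  set b : ℕ → ⨂[K]^m W := fun i => ∑ S ∈ (Finset.univ : Finset (Finset (Fin m))).filter (fun S => S.card = i), c S
    with hb
  have hreg : ∀ t : K, ∑ S : Finset (Fin m), t ^ S.card • c S = ∑ i ∈ Finset.range (m + 1), t ^ i • b i := by
    intro t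
    have hmaps : ∀ S ∈ (Finset.univ : Finset (Finset (Fin m))), S.card ∈ Finset.range (m + 1) := fun S _ => by
      rw [Finset.mem_range]
      have := S.card_le_univ
      rw [Fintype.card_fin] at this
      omega
    rw [← Finset.sum_fiberwise_of_maps_to hmaps]
    refine Finset.sum_congr rfl fun i _ => ?_
    rw [hb, Finset.smul_sum]
    refine Finset.sum_congr rfl fun S hS => ?_
    rw [(Finset.mem_filter.1 hS).2]
  have hconst : ∀ t : K, ∑ i ∈ Finset.range (m + 1), t ^ i • b i = y := fun t => by rw [← hreg, ← hexp, h]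
  -- the linear coefficient `b 1 = Σₖ c {k} = D_m(N) y` vanishes (for `m = 0` there is nothing to prove)
  rcases Nat.eq_zero_or_pos m with hm | hm
  · subst hm
    rw [piTensorDerivation_apply, Finset.univ_eq_empty, Finset.sum_empty, LinearMap.zero_apply]
  have hb1 : b 1 = 0 := eq_zero_of_forall_sum_pow_smul_eq m b y hconst le_rfl hm
  have hb1' : b 1 = ∑ k : Fin m, c {k} := by
    change (∑ S ∈ (Finset.univ : Finset (Finset (Fin m))).filter (fun S => S.card = 1), c S) = _
    have himg : (Finset.univ : Finset (Finset (Fin m))).filter (fun S => S.card = 1) =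
        Finset.univ.image fun k : Fin m => ({k} : Finset (Fin m)) := by
      ext S
      simp only [Finset.mem_filter, Finset.mem_univ, true_and, Finset.mem_image, Finset.card_eq_one]
      constructor
      · rintro ⟨a, rfl⟩; exact ⟨a, rfl⟩
      · rintro ⟨a, rfl⟩; exact ⟨a, rfl⟩
    rw [himg, Finset.sum_image fun k _ l _ hkl => Finset.singleton_injective hkl]
  have hck : ∀ k : Fin m, c {k} = piTensorSlot m k N y := by
    intro k
    rw [hc]
    change PiTensorProduct.map (Finset.piecewise {k} _ _) y = _
    rw [Finset.piecewise_singleton, piTensorSlot_apply]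
    rfl
  rw [piTensorDerivation_apply, LinearMap.sum_apply]
  calc ∑ k : Fin m, piTensorSlot m k N y = ∑ k : Fin m, c {k} := Finset.sum_congr rfl fun k _ => (hck k).symm
    _ = b 1 := hb1'.symm
    _ = 0 := hb1

end OneParameter

/-! ### §1 The complex covariant-tensor criterion: `Y ∈ 𝔥(H) ⊗ ℂ` iff `Y` is `Q_ℂ`-skew and kills the Hodge classes of the `T^{m,0}` -/

namespace HodgeStructure

universe u v w

/-- **`ρ_{k,0}(Y) (x ⊗ ⊗()) = (D_k(Y) x) ⊗ ⊗()`** over any field (on `T^{k,0}` the derivation action has no contravariant term;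
the tree's `tensorDerivation_toTensorSpaceZero` is the case `K = ℚ`). [cite: Deligne1982HodgeCycles, I §3.1] -/
theorem tensorDerivation_toTensorSpaceZeroOver {K : Type v} [Field K] {W : Type w} [AddCommGroup W] [Module K W] (k : ℕ)
    (Y : Module.End K W) (x : ⨂[K]^k W) :
    tensorDerivation k 0 Y (toTensorSpaceZeroOver K W k x) = toTensorSpaceZeroOver K W k (piTensorDerivation k Y x) := by
  rw [toTensorSpaceZeroOver_apply, toTensorSpaceZeroOver_apply, tensorDerivation_apply, LinearMap.sub_apply,
    LinearMap.rTensor_tmul, LinearMap.lTensor_tmul, piTensorDerivation_tprod, Finset.univ_eq_empty, Finset.sum_empty,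
    TensorProduct.tmul_zero, sub_zero]


variable {V : Type u} [AddCommGroup V] [Module ℚ V] [Module.Finite ℚ V] [HodgeTensorFacts.{u, u}] {n : ℤ}
  {H : HodgeStructure V n}

/-- **The covariant-tensor criterion over `ℂ` (tensor spaces `T^{m,0}`).** Let `Q` be a polarization of `H` and
`Y ∈ End_ℂ(V ⊗ ℂ)` be `Q_ℂ`-skew. If `ρ_{m,0}(Y)` kills the complexification `ι s` of every Hodge class `s` of type `(p,p)` of
every covariant tensor space `T^{m,0} H` (`mn = 2p`), then `Y ∈ 𝔥(H) ⊗ ℂ`: by `mem_hodgeLieC_iff` (`Hg` is defined over `ℚ`, so the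
complex annihilator of the rational Hodge tensors is `𝔥 ⊗ ℂ`) it suffices that `ρ_{a,b}(Y)` kill `ι t` for every Hodge tensor
`t ∈ T^{a,b}`; `κ t ⊗ ⊗() ∈ T^{a+b,0}` is a Hodge class (`Polarization.covariantize_mem_hodgeClasses`, `V^∨ ≅ V(n)` by `Q`), its
complexification is `κ_{θ_ℂ}(ι t) ⊗ ⊗()` (`tensorSpaceToBaseChange_covariantize`), which `Y` kills; by equivariance of `κ_{θ_ℂ}`
(`covariantize_tensorDerivation`, `θ_ℂ Y = −Yᵀ θ_ℂ` from skewness) and injectivity this is `ρ_{a,b}(Y)(ι t) = 0`. The complex form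
of GGK (I.B.1) «`M_φ` is the subgroup of `G = Aut(V,Q)` fixing the Hodge tensors» / Deligne I Prop. 3.4.
[cite: GreenGriffithsKerr2012, §I.B (I.B.1)] [cite: Deligne1982HodgeCycles, I §3.1, Prop. 3.4 and Prop. 3.6 (proof)] -/
theorem mem_hodgeLieC_of_skew_of_forall_tensorSpace_zero (Q : Polarization H) {Y : Module.End ℂ (ℂ ⊗[ℚ] V)}
    (hskew : ∀ x y, Q.form.baseChange ℂ (Y x) y + Q.form.baseChange ℂ x (Y y) = 0)
    (h : ∀ (m : ℕ) (p : ℤ), (m : ℤ) * n = 2 * p →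
      ∀ s ∈ (H.tensorSpace m 0).hodgeClasses p, tensorDerivation m 0 Y (tensorSpaceToBaseChange ℂ V m 0 s) = 0) :
    Y ∈ H.hodgeLieC := by
  rw [mem_hodgeLieC_iff]
  intro a b p hab t ht
  set θ : (ℂ ⊗[ℚ] V) ≃ₗ[ℂ] Module.Dual ℂ (ℂ ⊗[ℚ] V) := Q.toDualEquivC with hθdef
  have hθY : (θ : (ℂ ⊗[ℚ] V) →ₗ[ℂ] Module.Dual ℂ (ℂ ⊗[ℚ] V)) ∘ₗ Y =
      (-(Y.dualMap : Module.End ℂ (Module.Dual ℂ (ℂ ⊗[ℚ] V)))) ∘ₗ (θ : (ℂ ⊗[ℚ] V) →ₗ[ℂ] Module.Dual ℂ (ℂ ⊗[ℚ] V)) := by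
    refine LinearMap.ext fun x => LinearMap.ext fun y => ?_
    simp only [LinearMap.comp_apply, LinearEquiv.coe_coe, hθdef, Polarization.toDualEquivC_apply, LinearMap.neg_apply,
      LinearMap.dualMap_apply]
    linear_combination hskew x y
  have hmem := Q.covariantize_mem_hodgeClasses hab ht
  have hw : ((a + b : ℕ) : ℤ) * n = 2 * (p + b * n) := by push_cast; linear_combination hab
  have h0 := h (a + b) (p + b * n) hw _ hmem
  rw [Q.tensorSpaceToBaseChange_covariantize, ← toTensorSpaceZeroOver_apply, tensorDerivation_toTensorSpaceZeroOver, ← hθdef,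
    ← covariantize_tensorDerivation θ hθY, ← map_zero (toTensorSpaceZeroOver ℂ (ℂ ⊗[ℚ] V) (a + b))] at h0
  exact (covariantize_eq_zero_iff θ _).1 ((toTensorSpaceZeroOver_bijective ℂ (ℂ ⊗[ℚ] V) (a + b)).1 h0)

/-- **`𝔥(H) ⊗ ℂ ∩ 𝔰𝔭(Q_ℂ) = ` the `Q_ℂ`-skew complex annihilator of the Hodge classes of the `T^{m,0}`** (the `iff` form; `⟹`:
`formBaseChange_skew_of_mem_hodgeLieC` and `mem_hodgeLieC_iff`). [cite: GreenGriffithsKerr2012, §I.B (I.B.1)]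
[cite: Deligne1982HodgeCycles, I §3.1 and Prop. 3.4] -/
theorem mem_hodgeLieC_iff_skew_forall_tensorSpace_zero (Q : Polarization H) (Y : Module.End ℂ (ℂ ⊗[ℚ] V)) :
    Y ∈ H.hodgeLieC ↔ (∀ x y, Q.form.baseChange ℂ (Y x) y + Q.form.baseChange ℂ x (Y y) = 0) ∧
      ∀ (m : ℕ) (p : ℤ), (m : ℤ) * n = 2 * p →
        ∀ s ∈ (H.tensorSpace m 0).hodgeClasses p, tensorDerivation m 0 Y (tensorSpaceToBaseChange ℂ V m 0 s) = 0 := by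
  refine ⟨fun hY => ⟨fun x y => ?_, fun m p hmp s hs => (H.mem_hodgeLieC_iff Y).1 hY m 0 p (by simpa using hmp) s hs⟩,
    fun hY => mem_hodgeLieC_of_skew_of_forall_tensorSpace_zero Q hY.1 hY.2⟩
  rw [formBaseChange_skew_of_mem_hodgeLieC Q hY, neg_add_cancel]

end HodgeStructure

end Literature.AlgebraicGeometry.Motives

/-! ### §2 Complex abelian varieties: complex transvections of `S(A)(ℂ)` and the headline -/

namespace Literature.AlgebraicGeometry.HodgeTheory

open Literature.AlgebraicTopology.SingularHomology
open Literature.AlgebraicGeometry.Motives (IsSmoothProjective AbelianVariety bettiCohomology ComplexPoints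
  ofRatClassBaseChange ofRatClassBaseChange_tmul HodgeTensorFacts hodgeTensorFacts_holds)
open Literature.Barriers.HodgeConjecture
open Literature.AlgebraicGeometry.Motives.HodgeStructure
open Literature.RepresentationTheory.GeneralLinear
open Literature.AlgebraicGeometry.Milne1999
open Literature.AlgebraicGeometry.ComplexMultiplication

section Core

variable [HodgeTensorFacts.{0, 0}] {A : AbelianVariety ℂ}

/-- **Deligne I §3 ⟸ over `ℂ`, via one-parameter transvections.** Let `Y ∈ End_ℂ(H¹(A;ℚ) ⊗ ℂ)` be `ψ_ℂ`-skew. Suppose that for every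
`t ∈ ℂ` the operator `1 + tY`, transported to `H¹(A(ℂ); ℂ)`, is an automorphism `U_t ∈ (C(A) ⊗ ℂ)^×` (commutes with `End(A)`) whose
exterior diagonal action `⋀^{2p}(U_t^{⊕(a+1)})` fixes every rational `(p,p)`-class of every power `A^{a+1}`. Then `Y ∈ Lie Hg(H¹A) ⊗ ℂ`:
by the complex covariant criterion (§1) it suffices that `ρ_{m,0}(Y)` kill `ι s` for every Hodge class `s` of `T^{m,0} H¹(A)`;
`ι (y ⊗ ⊗()) = y_ℂ ⊗ ⊗()` and `ρ_{m,0}(Y)(y_ℂ ⊗ ⊗()) = (D_m(Y) y_ℂ) ⊗ ⊗()`; by §0 it suffices that `(1 + tY)^{⊗m} y_ℂ = y_ℂ` for all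
`t`, and under the injective equivariant tensor-letter map `Φ` of the tree (`tensorLetters_map`, `tensorLetters_injective`) this is
`⋀ᵐ(U_t^{⊕m}) Φ(y_ℂ) = Φ(y_ℂ)`, an instance of the hypothesis (`Φ(y_ℂ)` is a rational `(p,p)`-class, `isRationalClass_tensorLetters`,
`isOfHodgeType_tensorLetters`). [cite: Deligne1982HodgeCycles, I §3.1 and Prop. 3.4] [cite: Milne1999LefschetzClasses, Prop. 4.8 (p. 660)]
[cite: Borel1991, §3.9 and §7.3] -/
theorem mem_hodgeLieC_of_forall_diagPowExterior_one_add_smul (hHD : exists_isReal_hodgeModel)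
    (hI : hodgePQ_independent_of_hodgeModel)
    (ψ : (BettiUniverse.hodge hHD (AbelianVariety.isSmoothProjective_holds (A := A)) 1).Polarization)
    {Y : Module.End ℂ (ℂ ⊗[ℚ] bettiCohomology A.X 1)}
    (hskew : ∀ x y, ψ.form.baseChange ℂ (Y x) y + ψ.form.baseChange ℂ x (Y y) = 0)
    (hfix : ∀ t : ℂ, ∃ U : complexBetti A.X 1 ≃ₗ[ℂ] complexBetti A.X 1,
      (∀ x, U (ofRatClassBaseChangeEquiv (AbelianVariety.isSmoothProjective_holds (A := A)) 1 x) =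
        ofRatClassBaseChangeEquiv (AbelianVariety.isSmoothProjective_holds (A := A)) 1 (x + t • Y x)) ∧
      U ∈ centralizerGroup A ∧
      ∀ (a p : ℕ) (c : complexBetti (A.powSucc a).X (2 * p)), IsRationalClass c →
        IsOfHodgeType (A.powSucc a).dim (A.powSucc a).X (2 * p) p p c → diagPowExterior A U a (2 * p) c = c) :
    Y ∈ (BettiUniverse.hodge hHD (AbelianVariety.isSmoothProjective_holds (A := A)) 1).hodgeLieC := by
  classical
  haveI : Module.Finite ℚ (bettiCohomology A.X 1) := finite_bettiCohomology_one A
  set ρ := ofRatClassBaseChangeEquiv (AbelianVariety.isSmoothProjective_holds (A := A)) 1 with hρ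
  refine mem_hodgeLieC_of_skew_of_forall_tensorSpace_zero ψ hskew fun m p hmp s hs => ?_
  -- `m = 2 p'`
  have hmp' : (m : ℤ) = 2 * p := by simpa using hmp
  obtain ⟨p', rfl⟩ : ∃ p' : ℕ, p = p' := ⟨p.toNat, by omega⟩
  have hm : m = 2 * p' := by omega
  subst hm
  obtain ⟨y, rfl⟩ := toTensorSpaceZero_surjective (2 * p') s
  have hι := tensorSpaceToBaseChange_toTensorSpaceZero (V := bettiCohomology A.X 1) (2 * p') y
  rw [hι, tensorPowerEquivTensorSpaceZeroOver_apply, ← toTensorSpaceZeroOver_apply, tensorDerivation_toTensorSpaceZeroOver]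
  suffices h0 : Motives.piTensorDerivation (2 * p') Y (Motives.piTensorToBaseChange ℂ (bettiCohomology A.X 1) (2 * p') y) = 0 by
    rw [h0, map_zero]
  refine Motives.piTensorDerivation_apply_eq_zero_of_forall_map_one_add_smul (2 * p') Y _ fun t => ?_
  obtain ⟨U, hU, hUc, hUfix⟩ := hfix t
  -- the slots and the tensor-letter map
  set a := 2 * p' - 1 with ha
  set sl : Fin (2 * p') → Fin (a + 1) := fun i => ⟨i, by omega⟩ with hsl
  have hsli : Function.Injective sl := fun i i' h => Fin.ext (by simpa [hsl] using congrArg Fin.val h)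
  set Φ := PiTensorProduct.lift ((cupPowOne ℂ (ComplexPoints (A.powSucc a).X) (2 * p')).compLinearMap
    fun i : Fin (2 * p') => (complexBetti.map (avPowSlots A a (sl i)).hom.hom.hom 1).hom ∘ₗ ρ.toLinearMap) with hΦ
  apply tensorLetters_injective a (2 * p') hsli
  have hγ : ∀ x, U (ρ x) = ρ (((1 : Module.End ℂ (ℂ ⊗[ℚ] bettiCohomology A.X 1)) + t • Y) x) := fun x => by
    rw [hU x, LinearMap.add_apply, Module.End.one_apply, LinearMap.smul_apply]
  change Φ (PiTensorProduct.map (fun _ : Fin (2 * p') => (1 : Module.End ℂ (ℂ ⊗[ℚ] bettiCohomology A.X 1)) + t • Y)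
      (Motives.piTensorToBaseChange ℂ (bettiCohomology A.X 1) (2 * p') y)) =
    Φ (Motives.piTensorToBaseChange ℂ (bettiCohomology A.X 1) (2 * p') y)
  rw [hΦ, tensorLetters_map a (2 * p') sl hUc _ hγ]
  -- the class `Φ (y_ℂ)` is a rational `(p', p')`-class of `A^{a+1}`
  refine hUfix a p' _ (isRationalClass_tensorLetters a (2 * p') sl y) ?_
  have hT := isOfHodgeType_tensorLetters hHD hI ψ a (2 * p') sl rfl hs
  rwa [hι, LinearEquiv.symm_apply_apply] at hT

end Core

section Bridge

variable {A : AbelianVariety ℂ}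

open Literature.AlgebraicGeometry.VanGeemen1994 (pullbackOne hodgeClassSpan)
open Literature.Geometry.Kaehler (lefschetzPow)

/-- `(q • a) ⊗ 1 = q · (a ⊗ 1)` for the rational lattice map `Hᵏ(Y; ℚ) → Hᵏ(Y; ℂ)`. [folklore] -/
private theorem ofRatClass_rat_smul_ct {Y : Type} [TopologicalSpace Y] (k : ℕ) (q : ℚ) (a : singularCohomology ℚ ℚ Y k) :
    ofRatClass Y k (q • a) = (q : ℂ) • ofRatClass Y k a := by
  rw [← ofRatClassBaseChange_ofRat, ← ofRatClassBaseChange_ofRat, Motives.HodgeStructure.ofRat_apply,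
    Motives.HodgeStructure.ofRat_apply, TensorProduct.tmul_smul, ← algebraMap_smul ℂ q ((1 : ℂ) ⊗ₜ[ℚ] a), map_smul,
    eq_ratCast]

/-- **Every `ψ_ℂ`-symplectic `ℂ`-linear automorphism of `H¹(A(ℂ); ℚ) ⊗ ℂ` commuting with `End_Hdg(H¹) ⊗ ℂ` lies in Milne's
`S(A)(ℂ)`** (`S(A)` = «the largest algebraic subgroup of `Sp(e_D)` whose elements commute with the endomorphisms of `A`», §1
p. 644; here its COMPLEX points), for ANY complex abelian variety `A` of positive dimension, any polarization `ψ` of the Hodge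
structure `H¹(A(ℂ); ℚ)` and any Kähler–rational datum `D` (`h = η ⊗ 1`): transported to `H¹(A(ℂ); ℂ)` it commutes with every
`φ^*` (the rational `φ^*` are Hodge endomorphisms, `BettiUniverse.pull_hodge`) and preserves Milne's pairing
`Q_h(x, y) = h^{g-1} ⌣ x ⌣ y` — the tree's RATIONAL bridge `mem_unitaryCentralizerGroup_of_forall_form_eq_of_forall_comp_eq`
verbatim for a complex `U`: `Q_h` is, up to a non-zero scalar, the complexification of the rational form `B(v, w) = ψ(a v, w)`
with `a = ψ♭⁻¹ ∘ B♭` a HODGE endomorphism, and `U` commutes with `a ⊗ 1` and preserves `ψ_ℂ`, hence preserves `B ⊗ ℂ`.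
[cite: Milne1999LefschetzClasses, §1 pp. 642–644 and Prop. 4.8] [cite: LangeBirkenhake1992, Lemma 1.1.17 and Prop. 5.2.1] -/
theorem symm_trans_trans_mem_unitaryCentralizerGroup_of_forall_form_eq (hHD : exists_isReal_hodgeModel)
    (hI : hodgePQ_independent_of_hodgeModel) (hA0 : 0 < A.dim)
    (ψ : (BettiUniverse.hodge hHD (AbelianVariety.isSmoothProjective_holds (A := A)) 1).Polarization)
    (D : KaehlerRationalDatum A.dim A.X) {U : (ℂ ⊗[ℚ] bettiCohomology A.X 1) ≃ₗ[ℂ] (ℂ ⊗[ℚ] bettiCohomology A.X 1)}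
    (hu : ∀ x y, ψ.form.baseChange ℂ (U x) (U y) = ψ.form.baseChange ℂ x y)
    (huc : ∀ a : (BettiUniverse.hodge hHD (AbelianVariety.isSmoothProjective_holds (A := A)) 1).endAlg, ∀ z,
      U ((a : Module.End ℚ (bettiCohomology A.X 1)).baseChange ℂ z) = (a : Module.End ℚ (bettiCohomology A.X 1)).baseChange ℂ (U z)) :
    ((ofRatClassBaseChangeEquiv (AbelianVariety.isSmoothProjective_holds (A := A)) 1).symm.trans
        (U.trans (ofRatClassBaseChangeEquiv (AbelianVariety.isSmoothProjective_holds (A := A)) 1))) ∈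
      unitaryCentralizerGroup A D.Hη := by
  classical
  haveI : Module.Finite ℚ (bettiCohomology A.X 1) := finite_bettiCohomology_one A
  haveI : Module.Finite ℂ (complexBetti A.X 1) := finite_complexBetti_abelianVariety A 1
  have hX : IsSmoothProjective A.dim A.X := AbelianVariety.isSmoothProjective_holds
  have hA : A.dim = (A.dim - 1) + 1 := (Nat.sub_add_cancel hA0).symm
  have hX' : IsSmoothProjective (A.dim - 1 + 1) A.X := by rw [← hA]; exact hX
  set ρ := ofRatClassBaseChangeEquiv (AbelianVariety.isSmoothProjective_holds (A := A)) 1 with hρ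
  -- the datum
  have hQrat : IsRationalClass D.Hη := D.isRationalClass_Hη
  have hK1 : IsKaehlerClass A.dim A.X (((1 : ℝ) : ℂ) • D.Hη) := by
    rw [Complex.ofReal_one, one_smul]
    exact D.isKaehlerClassVia.isKaehlerClass D.isNatural D.isMultiplicative
  have hnd := eq_zero_of_forall_polarizationPairingOne_eq_zero_of_isKaehlerClass_smul' one_ne_zero hK1
  have h11' : IsOfHodgeType (A.dim - 1 + 1) A.X 2 1 1 D.Hη := by rw [← hA]; exact D.isOfHodgeType_Hη
  have hU : ∀ x, (ρ.symm.trans (U.trans ρ)) (ρ x) = ρ (U x) := fun x => by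
    simp only [LinearEquiv.trans_apply, LinearEquiv.symm_apply_apply]
  rw [mem_unitaryCentralizerGroup_iff]
  refine ⟨?_, ?_⟩
  · -- `U` commutes with every `φ^*`: the rational `φ^*` is a Hodge endomorphism
    rw [mem_centralizerGroup_iff]
    intro φ a'
    obtain ⟨x, rfl⟩ := ρ.surjective a'
    have hmem : BettiUniverse.pull φ.hom.hom.hom 1 ∈
        (BettiUniverse.hodge hHD (AbelianVariety.isSmoothProjective_holds (A := A)) 1).endAlg :=
      fun p => BettiUniverse.pull_hodge hHD hI hX hX φ.hom.hom.hom 1 p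
    have hpb : ∀ z, pullbackOne A φ (ρ z) = ρ ((BettiUniverse.pull φ.hom.hom.hom 1).baseChange ℂ z) := fun z =>
      complexBetti_map_ofRatClassBaseChangeEquiv hX hX φ.hom.hom.hom z
    rw [hU, hpb, hU, hpb, huc ⟨_, hmem⟩]
  -- the scalar symplectic form `B = lam ∘ Q_h`
  obtain ⟨B, -, -, lam, hlam, hBapp⟩ := exists_bilinForm_isAlt_nondegenerate (A := A) hnd
  -- the rational line `H^{2 dim A}(A(ℂ); ℚ)`
  haveI : Module.Finite ℚ (bettiCohomology A.X (2 + 2 * (A.dim - 1))) := finiteDimensional_bettiCohomology hX _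
  have hfrQ : Module.finrank ℚ (bettiCohomology A.X (2 + 2 * (A.dim - 1))) = 1 := by
    have h := (ofRatClassBaseChangeEquiv hX (2 + 2 * (A.dim - 1))).finrank_eq
    rwa [Module.finrank_baseChange, Motives.finrank_complexBetti_two_add_two_mul_eq_one hX'] at h
  set b1 := Module.finBasisOfFinrankEq ℚ (bettiCohomology A.X (2 + 2 * (A.dim - 1))) hfrQ with hb1
  set τ : bettiCohomology A.X (2 + 2 * (A.dim - 1)) →ₗ[ℚ] ℚ := b1.coord 0 with hτdef
  have hτ : ∀ r, r = τ r • b1 0 := fun r => by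
    conv_lhs => rw [← b1.sum_repr r, Fin.sum_univ_one]
    rfl
  have hω0 : ofRatClass (ComplexPoints A.X) _ (b1 0) ≠ 0 := fun h0 =>
    b1.ne_zero 0 (ofRatClass_injective _ (by rw [h0, map_zero]))
  have hlamω : lam (ofRatClass (ComplexPoints A.X) _ (b1 0)) ≠ 0 := fun h0 => hω0 (hlam (by rw [h0, map_zero]))
  -- the rational form `B_ℚ = τ ∘ Q_η`
  set Qℚ : bettiCohomology A.X 1 →ₗ[ℚ] bettiCohomology A.X 1 →ₗ[ℚ] bettiCohomology A.X (2 + 2 * (A.dim - 1)) :=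
    (cupProduct (R := ℚ) (X := ComplexPoints A.X) (rfl : 1 + 1 = 2)).compr₂ (lefschetzPow D.η (A.dim - 1) 2) with hQℚ
  set Bℚ : LinearMap.BilinForm ℚ (bettiCohomology A.X 1) := Qℚ.compr₂ τ with hBℚ
  have hQℚof : ∀ v w, ofRatClass (ComplexPoints A.X) _ (Qℚ v w) =
      Motives.polarizationPairingOne A.X D.Hη (A.dim - 1) (ofRatClass _ 1 v) (ofRatClass _ 1 w) := by
    intro v w
    simp only [hQℚ, LinearMap.compr₂_apply, Motives.polarizationPairingOne_apply]
    rw [D.ofRatClass_lefschetzPow, ofRatClass_eq_ringChange, singularCohomology.ringChange_cupProduct,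
      ← ofRatClass_eq_ringChange, ← ofRatClass_eq_ringChange]
  have hKEY : ∀ v w, B (ofRatClass _ 1 v) (ofRatClass _ 1 w) =
      (Bℚ v w : ℂ) * lam (ofRatClass (ComplexPoints A.X) _ (b1 0)) := by
    intro v w
    rw [hBapp, ← hQℚof, hτ (Qℚ v w), ofRatClass_rat_smul_ct, map_smul, smul_eq_mul]
    simp only [hBℚ, LinearMap.compr₂_apply]
  have hKEYC : ∀ x y, B (ρ x) (ρ y) = lam (ofRatClass (ComplexPoints A.X) _ (b1 0)) * Bℚ.baseChange ℂ x y := by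
    intro x y
    induction x using TensorProduct.induction_on with
    | zero => simp
    | add x₁ x₂ h₁ h₂ => simp only [map_add, LinearMap.add_apply, h₁, h₂, mul_add]
    | tmul c v =>
      induction y using TensorProduct.induction_on with
      | zero => simp
      | add y₁ y₂ h₁ h₂ => simp only [map_add, h₁, h₂, mul_add]
      | tmul d w =>
        rw [hρ, ofRatClassBaseChangeEquiv_apply, ofRatClassBaseChangeEquiv_apply, ofRatClassBaseChange_tmul,
          ofRatClassBaseChange_tmul]
        simp only [map_smul, LinearMap.smul_apply, smul_eq_mul]
        rw [hKEY, LinearMap.BilinForm.baseChange_tmul, Algebra.smul_def, eq_ratCast]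
        ring
  -- the comparison endomorphism `a`: `ψ(a v, w) = B_ℚ(v, w)`
  set a : Module.End ℚ (bettiCohomology A.X 1) := (ψ.toDualEquiv.symm : _ →ₗ[ℚ] _) ∘ₗ Bℚ with hadef
  have ha_form : ∀ v w, ψ.form (a v) w = Bℚ v w := fun v w => by
    simp only [hadef, LinearMap.comp_apply, LinearEquiv.coe_coe, Polarization.form_toDualEquiv_symm]
  have ha_formC : ∀ x y, ψ.form.baseChange ℂ (a.baseChange ℂ x) y = Bℚ.baseChange ℂ x y := by
    intro x y
    induction x using TensorProduct.induction_on with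
    | zero => simp
    | add x₁ x₂ h₁ h₂ => simp only [map_add, LinearMap.add_apply, h₁, h₂]
    | tmul c v =>
      induction y using TensorProduct.induction_on with
      | zero => simp
      | add y₁ y₂ h₁ h₂ => simp only [map_add, h₁, h₂]
      | tmul d w =>
        rw [LinearMap.baseChange_tmul, LinearMap.BilinForm.baseChange_tmul, LinearMap.BilinForm.baseChange_tmul, ha_form]
  -- `a ∈ End_Hdg(H¹)`: it preserves `F¹`
  have heff := BettiUniverse.hodge_isEffective hHD hX 1
  have hF0 : (BettiUniverse.hodge hHD hX 1).F 0 = ⊤ := by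
    rw [BettiUniverse.hodge_F]; exact HodgeModel.ratF_of_nonpos _ _ 1 le_rfl
  have hF1 : ∀ x ∈ (BettiUniverse.hodge hHD hX 1).F 1, ρ x ∈ hodgeOneZero hX' := by
    intro x hx
    have hx' : x ∈ (BettiUniverse.hodge hHD hX 1).piece 1 0 := by
      rw [piece_of_add_eq _ (by norm_num : (1 : ℤ) + 0 = ((1 : ℕ) : ℤ)), hF0, complexConj_top]
      exact ⟨hx, Submodule.mem_top⟩
    have h := (BettiUniverse.mem_hodge_piece_iff hHD hI hX (k := 1) (p := 1) (q := 0) rfl x).1 hx'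
    rw [mem_hodgeOneZero, ← hA]
    exact h
  have ha : a ∈ (BettiUniverse.hodge hHD hX 1).endAlg := by
    rw [mem_endAlg_iff]
    intro p
    rcases le_or_gt p 0 with hp | hp
    · rw [BettiUniverse.hodge_F, HodgeModel.ratF_of_nonpos _ _ 1 hp]
      exact le_top
    rcases le_or_gt p 1 with hp1 | hp1
    · obtain rfl : p = 1 := le_antisymm hp1 (by omega)
      rw [Submodule.map_le_iff_le_comap]
      intro x hx
      refine ψ.mem_F_one_of_forall_form_eq_zero Nat.cast_one heff fun y hy => ?_
      have hiso : Motives.polarizationPairingOne A.X D.Hη (A.dim - 1) (ρ x) (ρ y) = 0 :=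
        polarizationPairingOne_eq_zero_of_mem_hodgeOneZero hX' h11' (hF1 x hx) (hF1 y hy)
      have h := hKEYC x y
      rw [hBapp, hiso, map_zero] at h
      rw [ha_formC]
      exact (mul_eq_zero.1 h.symm).resolve_left hlamω
    · have hp2 : (((1 : ℕ) : ℤ)) < p := by push_cast; omega
      rw [BettiUniverse.hodge_F, HodgeModel.ratF_eq_bot _ _ 1 hp2, Submodule.map_bot]
  -- `ψ_ℂ` is `U`-invariant, hence so is `B_ℚ ⊗ ℂ = ψ_ℂ(a_ℂ ·, ·)` (`U` commutes with `a_ℂ`)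
  have hγB : ∀ x y, Bℚ.baseChange ℂ (U x) (U y) = Bℚ.baseChange ℂ x y := fun x y => by
    rw [← ha_formC, ← ha_formC, ← huc ⟨a, ha⟩, hu]
  -- conclusion
  intro a' b'
  obtain ⟨x, rfl⟩ := ρ.surjective a'
  obtain ⟨y, rfl⟩ := ρ.surjective b'
  apply hlam
  rw [← hBapp, ← hBapp, hU, hU, hKEYC, hKEYC, hγB]

end Bridge

/-! ### §3 The headline: square-zero `ψ_ℂ`-skew operators commuting with `End_Hdg ⊗ ℂ` lie in `Lie Hg(H¹A) ⊗ ℂ` when `A` is stably nondegenerate -/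

section Headline

variable [HodgeTensorFacts.{0, 0}] {A : AbelianVariety ℂ}

open Literature.AlgebraicGeometry.VanGeemen1994 (hodgeClassSpan)
open Literature.Geometry.Kaehler (lefschetzPow)

/-- **MILNE'S PROP. 4.8 (a) ⇒ (c), unipotent part OVER `ℂ`.** Let `A` be a STABLY NONDEGENERATE complex abelian variety of positive
dimension (`B(Aⁿ) = D(Aⁿ)` for all `n`) and `ψ` any polarization of the Hodge structure `H¹(A(ℂ); ℚ)`. Then every `ℂ`-linear
`Y ∈ End_ℂ(H¹(A;ℚ) ⊗ ℂ)` with `Y² = 0`, `ψ_ℂ`-skew and commuting with `a ⊗ 1` for every Hodge endomorphism `a ∈ End_Hdg(H¹(A;ℚ))`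
(`= End⁰(A)`, Riemann) lies in `Lie Hg(H¹A) ⊗ ℂ`. PROOF: the transvections `U_t = 1 + tY` (`t ∈ ℂ`; inverse `1 − tY`) are
`ψ_ℂ`-symplectic (`ψ_ℂ(Yx, Yy) = −ψ_ℂ(x, Y²y) = 0`) and commute with `End_Hdg ⊗ ℂ`, hence lie in `S(A)(ℂ)` (§2); under
condition (D) `S(A)(ℂ) = Hg′(A)(ℂ)` fixes the Hodge classes of all powers (Milne 4.8 (a) ⇒ (c) with Thm. 4.4, the tree's
`diagPowExterior_apply_eq_self_of_isStablyNondegenerate`); and §2's `mem_hodgeLieC_of_forall_diagPowExterior_one_add_smul`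
(Deligne I §3 over `ℂ`, differentiating in `t`) concludes. «The groups `Hg(A)` and `L(A)` are the largest algebraic subgroups …
fixing respectively the Hodge classes and the Lefschetz classes on the powers of `A`» — here on complex points and Lie algebras.
[cite: Milne1999LefschetzClasses, Prop. 4.8 (p. 660), Thm. 4.4 and §1 p. 644] [cite: MoonenZarhin1999LowDim, §1 (1.8)]
[cite: Deligne1982HodgeCycles, I §3 (proof of Prop. 3.4)] -/
theorem mem_hodgeLieC_of_isStablyNondegenerate_of_mul_self_eq_zero (hHD : exists_isReal_hodgeModel)
    (hI : hodgePQ_independent_of_hodgeModel) (hD : IsStablyNondegenerate A) (hA0 : 0 < A.dim)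
    (ψ : (BettiUniverse.hodge hHD (AbelianVariety.isSmoothProjective_holds (A := A)) 1).Polarization)
    {Y : Module.End ℂ (ℂ ⊗[ℚ] bettiCohomology A.X 1)} (hY2 : Y * Y = 0)
    (hskew : ∀ x y, ψ.form.baseChange ℂ (Y x) y + ψ.form.baseChange ℂ x (Y y) = 0)
    (hYc : ∀ a : (BettiUniverse.hodge hHD (AbelianVariety.isSmoothProjective_holds (A := A)) 1).endAlg,
      Y * (a : Module.End ℚ (bettiCohomology A.X 1)).baseChange ℂ = (a : Module.End ℚ (bettiCohomology A.X 1)).baseChange ℂ * Y) :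
    Y ∈ (BettiUniverse.hodge hHD (AbelianVariety.isSmoothProjective_holds (A := A)) 1).hodgeLieC := by
  classical
  haveI : Module.Finite ℚ (bettiCohomology A.X 1) := finite_bettiCohomology_one A
  have hX : IsSmoothProjective A.dim A.X := AbelianVariety.isSmoothProjective_holds
  obtain ⟨D⟩ := nonempty_kaehlerRationalDatum hX
  have hQrat : IsRationalClass D.Hη := D.isRationalClass_Hη
  have hK1 : IsKaehlerClass A.dim A.X (((1 : ℝ) : ℂ) • D.Hη) := by
    rw [Complex.ofReal_one, one_smul]
    exact D.isKaehlerClassVia.isKaehlerClass D.isNatural D.isMultiplicative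
  have hnd := eq_zero_of_forall_polarizationPairingOne_eq_zero_of_isKaehlerClass_smul' one_ne_zero hK1
  have hh : D.Hη ∈ hodgeClassSpan A.dim A.X 1 := mem_hodgeClassSpan_one_of_isKaehlerClass_smul hQrat one_ne_zero hK1
  have htop : lefschetzPow D.Hη (A.dim - 1) 2 D.Hη ≠ 0 := lefschetzPow_self_ne_zero_of_isKaehlerClass_smul hA0 hK1
  have hYY : ∀ x, Y (Y x) = 0 := fun x => by rw [← Module.End.mul_apply, hY2, LinearMap.zero_apply]
  refine mem_hodgeLieC_of_forall_diagPowExterior_one_add_smul hHD hI ψ hskew fun t => ?_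
  -- the transvection `U_t = 1 + tY`, inverse `1 - tY`
  have hinv₁ : ((1 : Module.End ℂ (ℂ ⊗[ℚ] bettiCohomology A.X 1)) + t • Y) ∘ₗ ((1 : Module.End ℂ _) - t • Y) = LinearMap.id := by
    apply LinearMap.ext
    intro x
    simp only [LinearMap.comp_apply, LinearMap.sub_apply, LinearMap.add_apply, Module.End.one_apply, LinearMap.smul_apply,
      map_sub, map_smul, hYY, smul_zero, LinearMap.id_apply]
    abel
  have hinv₂ : ((1 : Module.End ℂ (ℂ ⊗[ℚ] bettiCohomology A.X 1)) - t • Y) ∘ₗ ((1 : Module.End ℂ _) + t • Y) = LinearMap.id := by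
    apply LinearMap.ext
    intro x
    simp only [LinearMap.comp_apply, LinearMap.sub_apply, LinearMap.add_apply, Module.End.one_apply, LinearMap.smul_apply,
      map_add, map_smul, hYY, smul_zero, LinearMap.id_apply]
    abel
  set Ut : (ℂ ⊗[ℚ] bettiCohomology A.X 1) ≃ₗ[ℂ] (ℂ ⊗[ℚ] bettiCohomology A.X 1) :=
    LinearEquiv.ofLinear ((1 : Module.End ℂ _) + t • Y) ((1 : Module.End ℂ _) - t • Y) hinv₁ hinv₂ with hUt
  have hUt_apply : ∀ x, Ut x = x + t • Y x := fun x => rfl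
  -- `U_t` is `ψ_ℂ`-symplectic and commutes with `End_Hdg ⊗ ℂ`, hence lies in `S(A)(ℂ)`
  have hsymp : ∀ x y, ψ.form.baseChange ℂ (Ut x) (Ut y) = ψ.form.baseChange ℂ x y := by
    intro x y
    have h1 := hskew x y
    have h2 : ψ.form.baseChange ℂ (Y x) (Y y) = 0 := by
      have h3 := hskew x (Y y)
      rw [hYY, map_zero, add_zero] at h3
      exact h3
    simp only [hUt_apply, map_add, map_smul, LinearMap.add_apply, LinearMap.smul_apply, h2, smul_eq_mul, mul_zero,
      add_zero]
    linear_combination t * h1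
  have hcomm : ∀ a : (BettiUniverse.hodge hHD (AbelianVariety.isSmoothProjective_holds (A := A)) 1).endAlg, ∀ z,
      Ut ((a : Module.End ℚ (bettiCohomology A.X 1)).baseChange ℂ z) =
        (a : Module.End ℚ (bettiCohomology A.X 1)).baseChange ℂ (Ut z) := by
    intro a z
    rw [hUt_apply, hUt_apply, map_add, map_smul, ← Module.End.mul_apply, hYc a, Module.End.mul_apply]
  have hS := symm_trans_trans_mem_unitaryCentralizerGroup_of_forall_form_eq hHD hI hA0 ψ D hsymp hcomm
  refine ⟨(ofRatClassBaseChangeEquiv (AbelianVariety.isSmoothProjective_holds (A := A)) 1).symm.trans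
      (Ut.trans (ofRatClassBaseChangeEquiv (AbelianVariety.isSmoothProjective_holds (A := A)) 1)), fun x => ?_,
    unitaryCentralizerGroup_le_centralizerGroup hS, fun a p c hc hc' =>
    diagPowExterior_apply_eq_self_of_isStablyNondegenerate hD hA0 hh htop hnd hS a p hc hc'⟩
  rw [LinearEquiv.trans_apply, LinearEquiv.trans_apply, LinearEquiv.symm_apply_apply, hUt_apply]

/-- **The `ℂ`-span form**: for a stably nondegenerate `A` of positive dimension, the complex span of the square-zero `ψ_ℂ`-skew
operators commuting with `End_Hdg ⊗ ℂ` is contained in `Lie Hg(H¹A) ⊗ ℂ` (for a second factor of type II this span is all of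
`𝔰𝔭_D ⊗ ℂ`: the sequel `StablyNondegenerateHodgeLieTypeII`). [cite: Milne1999LefschetzClasses, Prop. 4.8 (p. 660)]
[cite: MoonenZarhin1999LowDim, §1 (1.8)] -/
theorem mem_hodgeLieC_of_isStablyNondegenerate_of_mem_span_transvections (hHD : exists_isReal_hodgeModel)
    (hI : hodgePQ_independent_of_hodgeModel) (hD : IsStablyNondegenerate A) (hA0 : 0 < A.dim)
    (ψ : (BettiUniverse.hodge hHD (AbelianVariety.isSmoothProjective_holds (A := A)) 1).Polarization)
    {Y : Module.End ℂ (ℂ ⊗[ℚ] bettiCohomology A.X 1)}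
    (hY : Y ∈ Submodule.span ℂ {N : Module.End ℂ (ℂ ⊗[ℚ] bettiCohomology A.X 1) | N * N = 0 ∧
      (∀ x y, ψ.form.baseChange ℂ (N x) y + ψ.form.baseChange ℂ x (N y) = 0) ∧
      ∀ a : (BettiUniverse.hodge hHD (AbelianVariety.isSmoothProjective_holds (A := A)) 1).endAlg,
        N * (a : Module.End ℚ (bettiCohomology A.X 1)).baseChange ℂ = (a : Module.End ℚ (bettiCohomology A.X 1)).baseChange ℂ * N}) :
    Y ∈ (BettiUniverse.hodge hHD (AbelianVariety.isSmoothProjective_holds (A := A)) 1).hodgeLieC := by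
  refine (Submodule.span_le.2 ?_) hY
  rintro N ⟨hN2, hNskew, hNc⟩
  exact mem_hodgeLieC_of_isStablyNondegenerate_of_mul_self_eq_zero hHD hI hD hA0 ψ hN2 hNskew hNc

end Headline

end Literature.AlgebraicGeometry.HodgeTheory

end
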